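import Mathlib
import Summits.Ventures.LatticeQCDFlow.Scaling.U1LayerWords

/-!
# LatticeQCDFlow / Scaling — the girth of a torus layer in the language of bonds: a word of at
# most three lateral plaquettes in which every vertical bond is shared is a single plaquette repeated

HONEST FRAMING: exact (Metropolis-corrected) sampling algorithms for lattice gauge theory;
figures of merit are autocorrelation/cost numbers at stated couplings and volumes; no
continuum-physics claim.

Venture `LatticeQCDFlow` (cell pub-lqcd), topic `Scaling`, FANOUT row 30 (lean-1) — OUR WORK, file
3 of the extension of the slab-chain proof of (LC)/(U′) to a general compact gauge group.  For
`U(1)` the girth entered through CHARGES of closed words (`U1LayerWords.wordChar_eq_one_of_closed`);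
for a non-abelian group the vertical Haar integral of a word of lateral plaquettes
`w : Fin m → LEdge` vanishes as soon as some vertical bond (a layer site) is touched by exactly ONE
letter (sequel file), so what is needed is the purely combinatorial statement proved here:
* `LEdge.Touches ℓ y` — the layer site `y` is an endpoint of the layer edge `ℓ`;
  `LEdge.eq_of_touches_src_tgt` — for side `L ≥ 3` an edge touching both endpoints of `ℓ` is `ℓ`
  (no reversed duplicates: `LEdge.not_reversed`);
* `single_add_single_ne_single` — for `L ≥ 4`, `±e_b ± e_c ≠ e_f` in `(ℤ/L)^d`: the layer graph has
  NO TRIANGLES (`LEdge.no_triangle`);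
* **`word_const_of_shared`** — for `L ≥ 4` and `m ≤ 3`: if every site touched by a letter of
  `w : Fin m → LEdge` is touched by another letter, then all letters of `w` are equal;
  contrapositive **`exists_lonely_of_not_const`**.
Elementary; nothing is cited as a fact; `def` `LEdge.Touches`; no `sorry`.
-/

noncomputable section

open Finset
open Literature.MathematicalPhysics.QuantumFieldTheory

namespace Summit.Ventures.LatticeQCDFlow.Theory2.Lattice.U1Layer

variable {d L : ℕ} [NeZero L] {a : Fin d}

namespace LEdge

/-- The layer site `y` is an endpoint of the layer edge `ℓ`. [folklore] -/
def Touches (ℓ : LEdge d L a) (y : LSite d L a) : Prop := ℓ.src = y ∨ ℓ.tgt = y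

/-- `Touches` is decidable. [folklore] -/
instance (ℓ : LEdge d L a) (y : LSite d L a) : Decidable (ℓ.Touches y) :=
  inferInstanceAs (Decidable (ℓ.src = y ∨ ℓ.tgt = y))

omit [NeZero L] in
/-- An edge touches its source. [folklore] -/
theorem touches_src (ℓ : LEdge d L a) : ℓ.Touches ℓ.src := Or.inl rfl

omit [NeZero L] in
/-- An edge touches its target. [folklore] -/
theorem touches_tgt (ℓ : LEdge d L a) : ℓ.Touches ℓ.tgt := Or.inr rfl

omit [NeZero L] in
/-- The target as a translate of the source in `(ℤ/L)^d`. [folklore] -/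
theorem tgt_val_eq (ℓ : LEdge d L a) : (ℓ.tgt.1 : Site d L) = ℓ.src.1 + Pi.single ℓ.dir 1 :=
  ℓ.tgt_val

omit [NeZero L] in
/-- Two edges with the same source and the same target are equal (`L ≥ 2`). [folklore] -/
theorem eq_of_src_eq_of_tgt_eq (hL : 2 ≤ L) {ℓ ℓ' : LEdge d L a} (hs : ℓ'.src = ℓ.src)
    (ht : ℓ'.tgt = ℓ.tgt) : ℓ' = ℓ := by
  refine ext_of_src_dir hs ?_
  have h1 : (ℓ'.tgt.1 : Site d L) = ℓ.tgt.1 := by rw [ht]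
  rw [tgt_val_eq, tgt_val_eq, hs, add_right_inj] at h1
  have h2 := congrFun h1 ℓ'.dir
  rw [Pi.single_eq_same, Pi.single_apply] at h2
  by_contra hne
  rw [if_neg hne] at h2
  haveI : Fact (1 < L) := ⟨by omega⟩
  exact one_ne_zero h2

omit [NeZero L] in
/-- **No reversed duplicates** (`L ≥ 3`): no edge goes from the target of `ℓ` back to its source.
[folklore] -/
theorem not_reversed (hL : 3 ≤ L) {ℓ ℓ' : LEdge d L a} (hs : ℓ'.src = ℓ.tgt) (ht : ℓ'.tgt = ℓ.src) :
    False := by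
  have h1 : (ℓ'.tgt.1 : Site d L) = ℓ.src.1 := by rw [ht]
  rw [tgt_val_eq, hs, tgt_val_eq, add_assoc, add_eq_left] at h1
  -- `e_{dir ℓ} + e_{dir ℓ'} = 0`: evaluate at `dir ℓ`
  have h2 := congrFun h1 ℓ.dir
  simp only [Pi.add_apply, Pi.single_eq_same, Pi.single_apply, Pi.zero_apply] at h2
  by_cases hd : ℓ.dir = ℓ'.dir
  · rw [if_pos hd] at h2
    have h3 : ((2 : ℕ) : ZMod L) = 0 := by
      rw [Nat.cast_ofNat]
      have : (1 : ZMod L) + 1 = 2 := by ring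
      rw [← this, h2]
    rw [ZMod.natCast_eq_zero_iff] at h3
    exact absurd (Nat.le_of_dvd (by norm_num) h3) (by omega)
  · rw [if_neg hd, add_zero] at h2
    haveI : Fact (1 < L) := ⟨by omega⟩
    exact one_ne_zero h2

/-- **An edge touching both endpoints of `ℓ` is `ℓ`** (`L ≥ 3`). [folklore] -/
theorem eq_of_touches_src_tgt (hL : 3 ≤ L) {ℓ ℓ' : LEdge d L a} (hs : ℓ'.Touches ℓ.src)
    (ht : ℓ'.Touches ℓ.tgt) : ℓ' = ℓ := by
  rcases hs with hs | hs <;> rcases ht with ht | ht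
  · exact absurd (hs.symm.trans ht) (tgt_ne_src (by omega) ℓ).symm
  · exact eq_of_src_eq_of_tgt_eq (by omega) hs ht
  · exact (not_reversed hL ht hs).elim
  · exact absurd (hs.symm.trans ht) (tgt_ne_src (by omega) ℓ).symm

end LEdge

/-! ## No triangles in a layer of side `≥ 4` -/

omit [NeZero L] in
/-- **`±e_b ± e_c ≠ e_f` in `(ℤ/L)^d` for `L ≥ 4`.** [folklore] -/
theorem single_add_single_ne_single (hL : 4 ≤ L) (b c f : Fin d) {σ τ : ZMod L}
    (hσ : σ = 1 ∨ σ = -1) (hτ : τ = 1 ∨ τ = -1) :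
    (Pi.single b σ + Pi.single c τ : Site d L) ≠ Pi.single f 1 := by
  haveI : Fact (1 < L) := ⟨by omega⟩
  -- units: `1 ≠ 0`, `-1 ≠ 0`, `±1 ± 1 ≠ 1`
  have h10 : (1 : ZMod L) ≠ 0 := one_ne_zero
  have hm10 : (-1 : ZMod L) ≠ 0 := neg_ne_zero.2 one_ne_zero
  have hσ0 : σ ≠ 0 := by rcases hσ with rfl | rfl <;> assumption
  have hτ0 : τ ≠ 0 := by rcases hτ with rfl | rfl <;> assumption
  have h2 : (2 : ZMod L) ≠ 1 := by
    intro h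
    have h' : ((1 : ℕ) : ZMod L) = 0 := by
      calc ((1 : ℕ) : ZMod L) = 2 - 1 := by norm_num
        _ = 0 := by rw [h, sub_self]
    rw [ZMod.natCast_eq_zero_iff] at h'
    exact absurd (Nat.le_of_dvd (by norm_num) h') (by omega)
  have hm2 : (-2 : ZMod L) ≠ 1 := by
    intro h
    have h' : ((3 : ℕ) : ZMod L) = 0 := by
      have : (1 : ZMod L) + 2 = 0 := by rw [← h]; ring
      rw [show ((3 : ℕ) : ZMod L) = 1 + 2 by push_cast; ring, this]
    rw [ZMod.natCast_eq_zero_iff] at h'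
    exact absurd (Nat.le_of_dvd (by norm_num) h') (by omega)
  have hsum : σ + τ ≠ 1 := by
    rcases hσ with rfl | rfl <;> rcases hτ with rfl | rfl
    · rw [show (1 : ZMod L) + 1 = 2 by ring]; exact h2
    · simp
    · simp
    · rw [show (-1 : ZMod L) + -1 = -2 by ring]; exact hm2
  intro h
  have hf := congrFun h f
  have hb := congrFun h b
  simp only [Pi.add_apply, Pi.single_eq_same, Pi.single_apply] at hf hb
  by_cases hbf : b = f
  · subst hbf
    rw [if_pos rfl] at hb
    by_cases hbc : b = c
    · rw [if_pos hbc] at hb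
      exact hsum hb
    · rw [if_neg hbc, add_zero] at hb
      have hc := congrFun h c
      simp only [Pi.add_apply, Pi.single_eq_same, Pi.single_apply] at hc
      rw [if_neg (fun h => hbc h.symm), if_neg (fun h => hbc h.symm), zero_add] at hc
      exact hτ0 hc
  · rw [if_neg hbf] at hb
    by_cases hbc : b = c
    · subst hbc
      rw [if_neg (fun h => hbf h.symm), if_neg (fun h => hbf h.symm), add_zero] at hf
      exact h10 hf.symm
    · rw [if_neg hbc, add_zero] at hb
      exact hσ0 hb

namespace LEdge

omit [NeZero L] in
/-- **No triangles** (`L ≥ 4`): if `ℓ₁` touches the source of `ℓ₀` and a site `p`, and `ℓ₂` touches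
the target of `ℓ₀` and the same `p`, with `p` the "other" endpoint of both, then contradiction.
Stated with explicit endpoint equations. [folklore] -/
theorem no_triangle (hL : 4 ≤ L) (ℓ₀ ℓ₁ ℓ₂ : LEdge d L a) (p : LSite d L a)
    (h₁ : (ℓ₁.src = ℓ₀.src ∧ ℓ₁.tgt = p) ∨ (ℓ₁.tgt = ℓ₀.src ∧ ℓ₁.src = p))
    (h₂ : (ℓ₂.src = ℓ₀.tgt ∧ ℓ₂.tgt = p) ∨ (ℓ₂.tgt = ℓ₀.tgt ∧ ℓ₂.src = p)) : False := by
  -- `p = src₀ ± e₁` and `p = src₀ + e₀ ± e₂`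
  have key : ∃ σ τ : ZMod L, (σ = 1 ∨ σ = -1) ∧ (τ = 1 ∨ τ = -1) ∧
      (p.1 : Site d L) = ℓ₀.src.1 + Pi.single ℓ₁.dir σ ∧
      (p.1 : Site d L) = ℓ₀.src.1 + Pi.single ℓ₀.dir 1 + Pi.single ℓ₂.dir τ := by
    have e0 := tgt_val_eq ℓ₀
    have e1 := tgt_val_eq ℓ₁
    have e2 := tgt_val_eq ℓ₂
    rcases h₁ with ⟨h1s, h1t⟩ | ⟨h1t, h1s⟩ <;> rcases h₂ with ⟨h2s, h2t⟩ | ⟨h2t, h2s⟩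
    · refine ⟨1, 1, Or.inl rfl, Or.inl rfl, ?_, ?_⟩
      · rw [← h1t, e1, h1s]
      · rw [← h2t, e2, h2s, e0]
    · refine ⟨1, -1, Or.inl rfl, Or.inr rfl, ?_, ?_⟩
      · rw [← h1t, e1, h1s]
      · have : (ℓ₀.tgt.1 : Site d L) = p.1 + Pi.single ℓ₂.dir 1 := by rw [← h2t, e2, h2s]
        rw [e0] at this
        rw [this, Pi.single_neg, add_neg_cancel_right]
    · refine ⟨-1, 1, Or.inr rfl, Or.inl rfl, ?_, ?_⟩
      · have : (ℓ₀.src.1 : Site d L) = p.1 + Pi.single ℓ₁.dir 1 := by rw [← h1t, e1, h1s]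
        rw [this, Pi.single_neg, add_neg_cancel_right]
      · rw [← h2t, e2, h2s, e0]
    · refine ⟨-1, -1, Or.inr rfl, Or.inr rfl, ?_, ?_⟩
      · have : (ℓ₀.src.1 : Site d L) = p.1 + Pi.single ℓ₁.dir 1 := by rw [← h1t, e1, h1s]
        rw [this, Pi.single_neg, add_neg_cancel_right]
      · have : (ℓ₀.tgt.1 : Site d L) = p.1 + Pi.single ℓ₂.dir 1 := by rw [← h2t, e2, h2s]
        rw [e0] at this
        rw [this, Pi.single_neg, add_neg_cancel_right]
  obtain ⟨σ, τ, hσ, hτ, hp1, hp2⟩ := key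
  have h : (Pi.single ℓ₁.dir σ + Pi.single ℓ₂.dir (-τ) : Site d L) = Pi.single ℓ₀.dir 1 := by
    have h' : (ℓ₀.src.1 : Site d L) + Pi.single ℓ₁.dir σ =
        ℓ₀.src.1 + Pi.single ℓ₀.dir 1 + Pi.single ℓ₂.dir τ := hp1.symm.trans hp2
    rw [add_assoc, add_right_inj] at h'
    rw [h', Pi.single_neg, add_neg_cancel_right]
  have hτ' : -τ = 1 ∨ -τ = -1 := by
    rcases hτ with rfl | rfl
    · exact Or.inr rfl
    · exact Or.inl (neg_neg 1)
  exact single_add_single_ne_single hL ℓ₁.dir ℓ₂.dir ℓ₀.dir hσ hτ' h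

end LEdge

/-! ## Words of at most three letters with all vertical bonds shared are constant -/

/-- The "other endpoint" of an edge touching `y`: an endpoint `p ≠ y` with the edge going between
`y` and `p`. [folklore] -/
theorem LEdge.exists_other (hL : 2 ≤ L) {ℓ : LEdge d L a} {y : LSite d L a} (h : ℓ.Touches y) :
    ∃ p : LSite d L a, ℓ.Touches p ∧ p ≠ y ∧
      ((ℓ.src = y ∧ ℓ.tgt = p) ∨ (ℓ.tgt = y ∧ ℓ.src = p)) := by
  rcases h with h | h
  · exact ⟨ℓ.tgt, ℓ.touches_tgt, fun he => LEdge.tgt_ne_src hL ℓ (he.trans h.symm), Or.inl ⟨h, rfl⟩⟩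
  · exact ⟨ℓ.src, ℓ.touches_src, fun he => LEdge.tgt_ne_src hL ℓ (h.trans he.symm), Or.inr ⟨h, rfl⟩⟩

omit [NeZero L] in
/-- If an edge touches `y` and `p ≠ y` via the explicit endpoint equations, it touches nothing
else. [folklore] -/
theorem LEdge.touches_iff_of_ends {ℓ : LEdge d L a} {y p z : LSite d L a}
    (h : (ℓ.src = y ∧ ℓ.tgt = p) ∨ (ℓ.tgt = y ∧ ℓ.src = p)) (hz : ℓ.Touches z) : z = y ∨ z = p := by
  rcases h with ⟨h1, h2⟩ | ⟨h1, h2⟩ <;> rcases hz with hz | hz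
  · exact Or.inl (hz.symm.trans h1)
  · exact Or.inr (hz.symm.trans h2)
  · exact Or.inr (hz.symm.trans h2)
  · exact Or.inl (hz.symm.trans h1)

/-- **THE GIRTH LEMMA IN BOND FORM.**  On a layer of side `L ≥ 4`, let `w : Fin m → LEdge` with
`m ≤ 3` be a word such that every site touched by some letter is touched by another letter.  Then
all letters are equal. [folklore] -/
theorem word_const_of_shared (hL : 4 ≤ L) {m : ℕ} (hm : m ≤ 3) (w : Fin m → LEdge d L a)
    (hsh : ∀ (k : Fin m) (y : LSite d L a), (w k).Touches y → ∃ k', k' ≠ k ∧ (w k').Touches y) :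
    ∀ k k' : Fin m, w k = w k' := by
  have hL3 : 3 ≤ L := by omega
  -- a letter all of whose endpoints are touched by ONE other letter equals it
  have two : ∀ k k' : Fin m, (∀ y, (w k).Touches y → (w k').Touches y) → w k' = w k :=
    fun k k' h => LEdge.eq_of_touches_src_tgt hL3 (h _ (w k).touches_src) (h _ (w k).touches_tgt)
  -- case analysis on `m ≤ 3`
  rcases Nat.lt_or_ge m 2 with hm2 | hm2
  · -- `m ≤ 1`: at most one letter
    intro k k'
    have : k = k' := Fin.ext (by omega)
    rw [this]
  rcases Nat.lt_or_ge m 3 with hm3 | hm3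
  · -- `m = 2`
    have hm2' : m = 2 := by omega
    subst hm2'
    have h01 : w 1 = w 0 := two 0 1 fun y hy => by
      obtain ⟨k', hk', hk'y⟩ := hsh 0 y hy
      have hk1 : k' = 1 := by
        rcases k' with ⟨k', hk'lt⟩
        simp only [ne_eq, Fin.ext_iff, Fin.val_zero, Fin.val_one] at hk' ⊢
        omega
      rw [hk1] at hk'y; exact hk'y
    have hall : ∀ k : Fin 2, w k = w 0 := by
      intro k
      fin_cases k
      · rfl
      · exact h01
    intro k k'
    rw [hall k, hall k']
  · -- `m = 3`
    have hm3' : m = 3 := by omega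
    subst hm3'
    -- if two letters coincide, the third has all its endpoints touched by them
    have pair : ∀ i j k : Fin 3, i ≠ j → i ≠ k → j ≠ k → w i = w j → w k = w i := by
      intro i j k hij hik hjk hwij
      refine (two k i fun y hy => ?_).symm
      obtain ⟨k', hk', hk'y⟩ := hsh k y hy
      have hor : k' = i ∨ k' = j := by
        rcases i with ⟨i, hi⟩; rcases j with ⟨j, hj⟩; rcases k with ⟨k, hk⟩
        rcases k' with ⟨k', hk'lt⟩
        simp only [ne_eq, Fin.ext_iff] at hij hik hjk hk' ⊢
        omega
      rcases hor with rfl | rfl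
      · exact hk'y
      · rw [← hwij] at hk'y; exact hk'y
    by_cases h01 : w 0 = w 1
    · have h2 := pair 0 1 2 (by decide) (by decide) (by decide) h01
      have hall : ∀ k : Fin 3, w k = w 0 := by
        intro k
        fin_cases k
        · rfl
        · exact h01.symm
        · exact h2
      intro k k'
      rw [hall k, hall k']
    by_cases h02 : w 0 = w 2
    · have h1 := pair 0 2 1 (by decide) (by decide) (by decide) h02
      exact absurd h1.symm h01
    by_cases h12 : w 1 = w 2
    · have h0 := pair 1 2 0 (by decide) (by decide) (by decide) h12
      exact absurd h0 h01
    -- all distinct: build a triangle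
    exfalso
    -- who touches the endpoints of `w 0`
    have cover : ∀ y, (w 0).Touches y → (w 1).Touches y ∨ (w 2).Touches y := by
      intro y hy
      obtain ⟨k', hk', hk'y⟩ := hsh 0 y hy
      fin_cases k'
      · exact absurd rfl hk'
      · exact Or.inl hk'y
      · exact Or.inr hk'y
    have n1 : ¬ ((w 1).Touches (w 0).src ∧ (w 1).Touches (w 0).tgt) :=
      fun h => h01 (LEdge.eq_of_touches_src_tgt hL3 h.1 h.2).symm
    have n2 : ¬ ((w 2).Touches (w 0).src ∧ (w 2).Touches (w 0).tgt) :=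
      fun h => h02 (LEdge.eq_of_touches_src_tgt hL3 h.1 h.2).symm
    -- symmetric roles of letters 1 and 2
    have main : ∀ i j : Fin 3, i ≠ 0 → j ≠ 0 → i ≠ j →
        (w i).Touches (w 0).src → ¬ (w i).Touches (w 0).tgt →
        (w j).Touches (w 0).tgt → ¬ (w j).Touches (w 0).src → False := by
      intro i j hi0 hj0 hij his hit hjt hjs
      -- the other endpoint `p` of `w i`
      obtain ⟨p, hip, hps, hends⟩ := LEdge.exists_other (by omega) his
      have hpt : p ≠ (w 0).tgt := fun h => hit (h ▸ hip)
      -- `p` is touched by another letter, necessarily `w j`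
      obtain ⟨k', hk', hk'p⟩ := hsh i p hip
      have hjp : (w j).Touches p := by
        have hk'0 : k' ≠ 0 := by
          rintro rfl
          rcases hk'p with h | h
          · exact hps h.symm
          · exact hpt h.symm
        have hkj : k' = j := by
          rcases i with ⟨i, hi⟩; rcases j with ⟨j, hj⟩; rcases k' with ⟨k', hk'lt⟩
          simp only [ne_eq, Fin.ext_iff, Fin.val_zero] at hi0 hj0 hij hk' hk'0 ⊢
          omega
        rw [hkj] at hk'p; exact hk'p
      -- the other endpoint `q` of `w j` (from the target of `w 0`)
      obtain ⟨q, hjq, hqt, hendsj⟩ := LEdge.exists_other (by omega) hjt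
      -- `p` is an endpoint of `w j` other than `tgt (w 0)`, so `p = q`
      have hpq : p = q := by
        rcases LEdge.touches_iff_of_ends hendsj hjp with h | h
        · exact absurd h hpt
        · exact h
      subst hpq
      exact LEdge.no_triangle hL (w 0) (w i) (w j) p hends hendsj
    rcases cover _ (w 0).touches_src with h1s | h2s
    · have h1t : ¬ (w 1).Touches (w 0).tgt := fun h => n1 ⟨h1s, h⟩
      rcases cover _ (w 0).touches_tgt with h1t' | h2t
      · exact h1t h1t'
      · have h2s : ¬ (w 2).Touches (w 0).src := fun h => n2 ⟨h, h2t⟩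
        exact main 1 2 (by decide) (by decide) (by decide) h1s h1t h2t h2s
    · by_cases h1s : (w 1).Touches (w 0).src
      · have h1t : ¬ (w 1).Touches (w 0).tgt := fun h => n1 ⟨h1s, h⟩
        rcases cover _ (w 0).touches_tgt with h1t' | h2t
        · exact h1t h1t'
        · exact n2 ⟨h2s, h2t⟩
      · have h2t : ¬ (w 2).Touches (w 0).tgt := fun h => n2 ⟨h2s, h⟩
        rcases cover _ (w 0).touches_tgt with h1t | h2t'
        · exact main 2 1 (by decide) (by decide) (by decide) h2s h2t h1t h1s
        · exact h2t h2t'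

/-- **Contrapositive**: a non-constant word of length `≤ 3` on a layer of side `≥ 4` has a LONELY
site — a site touched by exactly one letter. [folklore] -/
theorem exists_lonely_of_not_const (hL : 4 ≤ L) {m : ℕ} (hm : m ≤ 3) (w : Fin m → LEdge d L a)
    (hw : ¬ ∀ k k' : Fin m, w k = w k') :
    ∃ (k : Fin m) (y : LSite d L a), (w k).Touches y ∧ ∀ k', k' ≠ k → ¬ (w k').Touches y := by
  by_contra h
  refine hw (word_const_of_shared hL hm w fun k y hy => ?_)
  by_contra hc
  exact h ⟨k, y, hy, fun k' hk' ht => hc ⟨k', hk', ht⟩⟩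

end Summit.Ventures.LatticeQCDFlow.Theory2.Lattice.U1Layer

end
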